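import Summits.BirchSwinnertonDyer.BirchSwinnertonDyer.Theorems.AlignedTransportAtTwoMainConjectureOfRankZeroBSDAtTwoCubicLayerTwoRelationDoor
import Summits.BirchSwinnertonDyer.BirchSwinnertonDyer.Theorems.AlignedTransportAtTwoMainConjectureOfRankZeroBSDAtTwoCubicOrderFourRowN4307Exact
import Summits.BirchSwinnertonDyer.BirchSwinnertonDyer.Theorems.AlignedTransportAtTwoMainConjectureOfRankZeroBSDAtTwoCubicDoorsDeadSubcellClassNumberB
import Literature.NumberTheory.NumberFields.CubicFieldIntegers
import Literature.NumberTheory.NumberFields.CubicFieldResiduePrimes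
import HarnessLib

/-!
# Route `AlignedTransportAtTwo`, crux C2 `MainConjectureOfRankZeroBSDAtTwo` (stmt-BirchSwinnertonDyer-22298):
# ROW `N = 4307` (CONVERSE QUADRANT, `t = 4 ∧ e₁ ≥ 2`) BY THE RELATION ROAD AT LAYER TWO: ★★★ **`rank₂ Cl(K_m) ≤ 2 ∀ m`, `μ₂ = 0`, `λ₂ ≤ 2` — UNCONDITIONALLY —
# for every cyclotomic `ℤ₂`-extension of the cubic `2`-torsion field `ℚ(β)` of `⟨1, 0, 0, -3, -4⟩`**, from ONE relation `c·(σc)²·σ²c = 1` in `Cl(K_2)`, `K_2 = ℚ(β)·ℚ(ζ₁₆)⁺`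

HONEST FRAMING (cell `bsd-f1-sign2`, WIDTH-5 attached prover seat `bsd-line-att-p4` gen 43 on line `birth` of the lead `bsd-line-att-p2`;
`--supports` stmt-BirchSwinnertonDyer-22298, closes nothing; BSD is NOT proved by any of this; the crux C2, its verdict «blocked-on
`Rank1Residual.GreenbergMuConjectureIrreducible`» and every registered stub are untouched).  THEOREMS ONLY (no `def`, no named fact, no instance, no `sorry`).

WHAT.  `W = ⟨1, 0, 0, -3, -4⟩` (`N = 4307`, `Δ_min ≡ 5 (mod 8)`, `Δ_W < 0`, good ordinary at `2`, `E[2]` irreducible; cubic `2`-torsion field `K = ℚ(β) = ℚ(θ)`, `f(θ) = 0`,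
`f = X³ + (-3)X² + (-1)X + (-10)`, `h_K = 1`, `𝓞_K = ℤ[θ]` — att-p4 g38 `…CubicDoorsDeadSubcellClassNumberB`, `CubicDisc4307`) is a seed of the cell's CONVERSE QUADRANT: unit depth `t = 4`
(`ε = 3463 + (1232)θ + (1354)θ²`, `ε + 1 ∈ 𝔭₁³`, `𝔭₁ = (π₁)`, `π₁ = -4 + (1)θ + (0)θ²`), `e₁ ≥ 2` — no unit / depth / order-four / elementary-layer
door of the tree decides `μ₂` there (att-p3 g45/g49 census: «first kernel road»).  WHAT FIRES: the LAYER-TWO RELATION ROAD (this seat's g43 coordinate kernel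
`…CubicLayerTwoRelationDoor` on att-p3 g49's t-free door): with `q₀ = -11 + (3)θ + (0)θ²` (norm `127`, `(q₀) = (127, θ − 46)` maximal, `q₀ ≡ +3 (mod 𝔭₁³)`),
`t = 42` (`P₂(42) ≡ 0 (mod 127)`), `𝔠 = (q₀², s₂ − 42)` and `σ : s₂ ↦ s₂³ − 3s₂`: **`𝔠·(σ𝔠)²·σ²𝔠 = (q₀², (42² − 2 − s₁)(σs₂ − 42)²) = (y)`** with
`y = [[1, -5, -2], [-6, 1, -2], [-4, 1, 0], [1, -1, 0]]` on `(1, s₁, s₂, s₁s₂)` (found by LLL in the degree-`12` field on the seat, pure python seconds; `N_{K_2/K}(y) = ε_y q₀⁴`), relation polynomial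
`(1 + X)² = (X − 1)² + 2·2X`, `d = 2 ≤ 2² − 2`; every identity decided by the kernel in `ℤ[θ]` (one `linear_combination` against `f(θ) = 0` each), residues by `decide`.
THEN (★★★ `classGroupPRank_le_two_and_mu_lambda_cubicField_n4307`, UNCONDITIONAL) for `β` ANY root of the `2`-division cubic and EVERY cyclotomic `ℤ₂`-extension `κ`
of `ℚ(β)`: `rank₂ Cl(K_m) ≤ 2 ∀ m`, `μ₂(κ) = 0`, `λ₂(κ) ≤ 2`; and (★) `MC₂(W)` modulo PRINT⁵ + MuIneqʳ + the crux's own hypotheses (att-p5 g24's carrier road).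
BSD is NOT proved; nothing is closed; C2's verdict is untouched.

References: [Washington1997] §13.1, §13.3 Prop. 13.22–13.23; [Lang1990] Ch. 13 §4 Lemma 4.1; [Fukuda1994] Thm. 1; [Gras2003] IV.4; [NeukirchANT1999] Ch. I §3, §8,
Ch. III (1.6)–(1.7); [Cohen1993] §4.7, §6.5; [Marcus2018] Ch. 3 Thm. 27; [LMFDB] ec 4307, nf 3.1.4307.1; [Kato2004Asterisque] Thm. 17.4; [GreenbergLNM1716] Thm. 4.1;
tree: this seat's `…CubicLayerTwoRelationDoor`, `Literature/…/ClassicalMuVanishesLayerTwoRelationCertificateTwo`, `…/SqrtTwoTowerTwoGaloisAction`, att-p4 g38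
`…CubicDoorsDeadSubcellClassNumberB`, `CubicDisc4307`, att-p5 g24 `…CubicCarrierRoad`.
-/

set_option linter.dupNamespace false
set_option autoImplicit false

noncomputable section

open scoped Classical NumberField nonZeroDivisors IntermediateField

namespace Summit.BirchSwinnertonDyer.BirchSwinnertonDyer.Theorems.AlignedTransportAtTwoCubicLayerTwoRelationRowN4307

open NumberField IsDedekindDomain Polynomial WeierstrassCurve IntermediateField CongruenceSubgroup Module
  Literature.NumberTheory.IwasawaTheory Literature.NumberTheory.GaloisRepresentations
  Literature.NumberTheory.EllipticCurves Literature.NumberTheory.EllipticCurves.Greenberg1999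
  Literature.NumberTheory.EllipticCurves.ModularForms Literature.NumberTheory.EllipticCurves.Rank1Residual
  Literature.NumberTheory.EllipticCurves.Module
  Literature.NumberTheory.NumberFields Literature.NumberTheory.CubicFields
  Summit.BirchSwinnertonDyer.Rank1Residual Summit.BirchSwinnertonDyer.Rank1Residual.X1.MuLambda
  Summit.BirchSwinnertonDyer.Rank1Residual.X5 Summit.BirchSwinnertonDyer.Rank1Residual.X5.O1
  Summit.BirchSwinnertonDyer.Rank1Residual.X5.Instances Summit.BirchSwinnertonDyer.Rank1Residual.F1Sign2
  Summit.BirchSwinnertonDyer.BirchSwinnertonDyer.Theorems.Rank1ResidualX1Defs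
  Summit.BirchSwinnertonDyer.BirchSwinnertonDyer.Theorems.AlignedTransportAtTwoCubicCarrierRoad
  Summit.BirchSwinnertonDyer.BirchSwinnertonDyer.Theorems.AlignedTransportAtTwoCubicDoorsDeadSubcellClassNumberB
  Summit.BirchSwinnertonDyer.BirchSwinnertonDyer.Theorems.AlignedTransportAtTwoCubicLayerTwoRelationDoor

/-! ## §1 Residue maps of `𝓞_{ℚ(β)} = ℤ[θ]` -/

/-- `ψ_127 : 𝓞 → ℤ/127`, `θ ↦ 46` — the degree-one prime `(127, θ − 46) = (q₀)`. [cite: Marcus2018, Ch. 3, Thm. 27] -/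
theorem exists_residueHom_q {β : AlgebraicClosure ℚ} (hβ : aeval β ((⟨1, 0, 0, -3, -4⟩ : WeierstrassCurve ℤ).baseChange ℚ).twoTorsionPolynomial.toPoly = 0) :
    ∃ ψ : 𝓞 ↥(IntermediateField.adjoin ℚ ({β} : Set (AlgebraicClosure ℚ))) →+* ZMod 127, ψ (MonicCubic.thetaInt (aeval_theta_n4307 hβ)) = ((46 : ℤ) : ZMod 127) :=
  haveI : FiniteDimensional ℚ ↥(IntermediateField.adjoin ℚ ({β} : Set (AlgebraicClosure ℚ))) := IntermediateField.adjoin.finiteDimensional ((AlgebraicClosure.isAlgebraic ℚ).isAlgebraic β).isIntegral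
  haveI : NumberField ↥(IntermediateField.adjoin ℚ ({β} : Set (AlgebraicClosure ℚ))) := NumberField.mk
  MonicCubic.exists_ringHom_of_root CubicDisc4307.irreducible_polyQ (aeval_theta_n4307 hβ) (finrank_cubicField_n4307 hβ)
    CubicDisc4307.isUnit_of_disc_eq_sq_mul ((46 : ℤ) : ZMod 127) (by decide)

/-- **`N((π₁)) = 2`**, `π₁ = -4 + (1)θ + (0)θ²`: `(2, θ) = (π₁)` (`CubicDisc4307.span_2_lin0_eq`) is the kernel of `ψ₂`. [cite: Marcus2018, Ch. 3, Thm. 27] -/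
theorem absNorm_span_pi1_n4307 {β : AlgebraicClosure ℚ} (hβ : aeval β ((⟨1, 0, 0, -3, -4⟩ : WeierstrassCurve ℤ).baseChange ℚ).twoTorsionPolynomial.toPoly = 0) :
    haveI : FiniteDimensional ℚ ↥(IntermediateField.adjoin ℚ ({β} : Set (AlgebraicClosure ℚ))) := IntermediateField.adjoin.finiteDimensional ((AlgebraicClosure.isAlgebraic ℚ).isAlgebraic β).isIntegral
    haveI : NumberField ↥(IntermediateField.adjoin ℚ ({β} : Set (AlgebraicClosure ℚ))) := NumberField.mk
    Ideal.absNorm (Ideal.span {(-4 + MonicCubic.thetaInt (aeval_theta_n4307 hβ) : 𝓞 ↥(IntermediateField.adjoin ℚ ({β} : Set (AlgebraicClosure ℚ))))}) = 2 := by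
  haveI : FiniteDimensional ℚ ↥(IntermediateField.adjoin ℚ ({β} : Set (AlgebraicClosure ℚ))) := IntermediateField.adjoin.finiteDimensional ((AlgebraicClosure.isAlgebraic ℚ).isAlgebraic β).isIntegral
  haveI : NumberField ↥(IntermediateField.adjoin ℚ ({β} : Set (AlgebraicClosure ℚ))) := NumberField.mk
  haveI : Fact (Nat.Prime 2) := ⟨Nat.prime_two⟩
  have hθ := aeval_theta_n4307 hβ
  have h3 := finrank_cubicField_n4307 hβ
  obtain ⟨ψ, hψ⟩ := Summit.BirchSwinnertonDyer.BirchSwinnertonDyer.Theorems.AlignedTransportAtTwoCubicOrderFourRowN4307.exists_residueHom_two_n4307 hβ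
  set θI : 𝓞 ↥(IntermediateField.adjoin ℚ ({β} : Set (AlgebraicClosure ℚ))) := MonicCubic.thetaInt hθ with hθI
  have hexp : ¬ 2 ∣ RingOfIntegers.exponent (MonicCubic.thetaInt hθ) := by
    rw [MonicCubic.exponent_thetaInt CubicDisc4307.irreducible_polyQ hθ h3 CubicDisc4307.isUnit_of_disc_eq_sq_mul]; decide
  have hker := MonicCubic.ker_residueHom_eq_span CubicDisc4307.irreducible_polyQ hθ hexp ψ hψ
  have hspan : Ideal.span {((2 : ℕ) : 𝓞 ↥(IntermediateField.adjoin ℚ ({β} : Set (AlgebraicClosure ℚ)))), MonicCubic.thetaInt hθ - (((0) : ℤ) : 𝓞 ↥(IntermediateField.adjoin ℚ ({β} : Set (AlgebraicClosure ℚ))))} = Ideal.span {(-4 + MonicCubic.thetaInt hθ : 𝓞 ↥(IntermediateField.adjoin ℚ ({β} : Set (AlgebraicClosure ℚ))))} := by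
    rw [Nat.cast_ofNat, show MonicCubic.thetaInt hθ - (((0) : ℤ) : 𝓞 ↥(IntermediateField.adjoin ℚ ({β} : Set (AlgebraicClosure ℚ)))) = MonicCubic.thetaInt hθ by push_cast; ring]
    exact CubicDisc4307.span_2_lin0_eq hθ
  rw [← hspan, ← hker]
  exact absNorm_ker_zmod ψ

/-- **`(q₀) = (127, θ − 46)` is maximal** (kernel of `ψ_127`; `127 = q₀·q₀'`, `θ − 46 = q₀·w`, `q₀ ∈ (127, θ − 46)` with explicit witnesses). [cite: Marcus2018, Ch. 3, Thm. 27] -/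
theorem isMaximal_span_q0_n4307 {β : AlgebraicClosure ℚ} (hβ : aeval β ((⟨1, 0, 0, -3, -4⟩ : WeierstrassCurve ℤ).baseChange ℚ).twoTorsionPolynomial.toPoly = 0) :
    haveI : FiniteDimensional ℚ ↥(IntermediateField.adjoin ℚ ({β} : Set (AlgebraicClosure ℚ))) := IntermediateField.adjoin.finiteDimensional ((AlgebraicClosure.isAlgebraic ℚ).isAlgebraic β).isIntegral
    haveI : NumberField ↥(IntermediateField.adjoin ℚ ({β} : Set (AlgebraicClosure ℚ))) := NumberField.mk
    (Ideal.span {(((-11) + 3 * MonicCubic.thetaInt (aeval_theta_n4307 hβ) : 𝓞 ↥(IntermediateField.adjoin ℚ ({β} : Set (AlgebraicClosure ℚ)))))}).IsMaximal := by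
  haveI : FiniteDimensional ℚ ↥(IntermediateField.adjoin ℚ ({β} : Set (AlgebraicClosure ℚ))) := IntermediateField.adjoin.finiteDimensional ((AlgebraicClosure.isAlgebraic ℚ).isAlgebraic β).isIntegral
  haveI : NumberField ↥(IntermediateField.adjoin ℚ ({β} : Set (AlgebraicClosure ℚ))) := NumberField.mk
  haveI : Fact (Nat.Prime 127) := ⟨by norm_num⟩
  have hθ := aeval_theta_n4307 hβ
  have h3 := finrank_cubicField_n4307 hβ
  obtain ⟨ψ, hψ⟩ := exists_residueHom_q hβ
  set θI : 𝓞 ↥(IntermediateField.adjoin ℚ ({β} : Set (AlgebraicClosure ℚ))) := MonicCubic.thetaInt hθ with hθI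
  have hrel : θI ^ 3 + (-3 : 𝓞 ↥(IntermediateField.adjoin ℚ ({β} : Set (AlgebraicClosure ℚ)))) * θI ^ 2 + (-1 : 𝓞 ↥(IntermediateField.adjoin ℚ ({β} : Set (AlgebraicClosure ℚ)))) * θI + (-10 : 𝓞 ↥(IntermediateField.adjoin ℚ ({β} : Set (AlgebraicClosure ℚ)))) = 0 := by
    have h := MonicCubic.thetaInt_rel hθ
    rw [← hθI] at h
    push_cast at h
    linear_combination h
  have hexp : ¬ 127 ∣ RingOfIntegers.exponent (MonicCubic.thetaInt hθ) := by
    rw [MonicCubic.exponent_thetaInt CubicDisc4307.irreducible_polyQ hθ h3 CubicDisc4307.isUnit_of_disc_eq_sq_mul]; decide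
  have hker := MonicCubic.ker_residueHom_eq_span CubicDisc4307.irreducible_polyQ hθ hexp ψ hψ
  have hspan : Ideal.span {((127 : ℕ) : 𝓞 ↥(IntermediateField.adjoin ℚ ({β} : Set (AlgebraicClosure ℚ)))), MonicCubic.thetaInt hθ - ((46 : ℤ) : 𝓞 ↥(IntermediateField.adjoin ℚ ({β} : Set (AlgebraicClosure ℚ))))} = Ideal.span {(((-11) + 3 * θI : 𝓞 ↥(IntermediateField.adjoin ℚ ({β} : Set (AlgebraicClosure ℚ)))))} := by
    rw [← hθI]
    apply le_antisymm
    · rw [Ideal.span_le]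
      intro w hw
      simp only [Set.mem_insert_iff, Set.mem_singleton_iff] at hw
      rcases hw with rfl | rfl
      · exact Ideal.mem_span_singleton'.mpr ⟨(13 + 6 * θI + 9 * θI ^ 2 : 𝓞 ↥(IntermediateField.adjoin ℚ ({β} : Set (AlgebraicClosure ℚ)))), by push_cast; linear_combination (27 : 𝓞 ↥(IntermediateField.adjoin ℚ ({β} : Set (AlgebraicClosure ℚ)))) * hrel⟩
      · exact Ideal.mem_span_singleton'.mpr ⟨((-4) + (-2) * θI + (-3) * θI ^ 2 : 𝓞 ↥(IntermediateField.adjoin ℚ ({β} : Set (AlgebraicClosure ℚ)))), by push_cast; linear_combination ((-9) : 𝓞 ↥(IntermediateField.adjoin ℚ ({β} : Set (AlgebraicClosure ℚ)))) * hrel⟩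
    · rw [Ideal.span_singleton_le_iff_mem, Ideal.mem_span_pair]
      exact ⟨(1 : 𝓞 ↥(IntermediateField.adjoin ℚ ({β} : Set (AlgebraicClosure ℚ)))), (3 : 𝓞 ↥(IntermediateField.adjoin ℚ ({β} : Set (AlgebraicClosure ℚ)))), by push_cast; linear_combination (0 : 𝓞 ↥(IntermediateField.adjoin ℚ ({β} : Set (AlgebraicClosure ℚ)))) * hrel⟩
  rw [← hspan, ← hker]
  exact ker_zmod_isMaximal ψ

/-! ## §2 ★★★ The relation row at layer two: `rank₂ ≤ 2`, `μ₂ = 0`, `λ₂ ≤ 2` — UNCONDITIONAL -/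

set_option maxHeartbeats 4000000 in
/-- ★★★ **`rank₂ Cl(K_m) ≤ 2 ∀ m`, `μ₂ = 0`, `λ₂ ≤ 2` — UNCONDITIONAL — for every cyclotomic `ℤ₂`-extension of the cubic `2`-torsion field of `⟨1, 0, 0, -3, -4⟩`**
(`N = 4307`, converse quadrant): the layer-two relation door in coordinates with the datum `q₀`, `t = 42`, `y`, `N(y) = ε_y q₀⁴`, square and comaximality witnesses.
[cite: Washington1997, §13.3 Prop. 13.22–13.23] [cite: Lang1990, Ch. 13 §4 Lemma 4.1] [cite: Fukuda1994, Thm. 1, p. 264] [cite: Cohen1993, §6.5] [cite: LMFDB, number field 3.1.4307.1] -/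
theorem classGroupPRank_le_two_and_mu_lambda_cubicField_n4307 {β : AlgebraicClosure ℚ} (hβ : aeval β ((⟨1, 0, 0, -3, -4⟩ : WeierstrassCurve ℤ).baseChange ℚ).twoTorsionPolynomial.toPoly = 0)
    (κP : ZpExtension ↥(IntermediateField.adjoin ℚ ({β} : Set (AlgebraicClosure ℚ))) 2) (hκP : κP.IsCyclotomic) :
    (∀ m, classGroupPRank κP m ≤ 2) ∧ ClassicalMuVanishes κP ∧ classicalLambda κP ≤ 2 := by
  haveI := isElliptic_n4307
  haveI := isGloballyMinimal_n4307
  haveI : FiniteDimensional ℚ ↥(IntermediateField.adjoin ℚ ({β} : Set (AlgebraicClosure ℚ))) := IntermediateField.adjoin.finiteDimensional ((AlgebraicClosure.isAlgebraic ℚ).isAlgebraic β).isIntegral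
  haveI : NumberField ↥(IntermediateField.adjoin ℚ ({β} : Set (AlgebraicClosure ℚ))) := NumberField.mk
  have hord : IsOrdinaryAt ((⟨1, 0, 0, -3, -4⟩ : WeierstrassCurve ℤ).baseChange ℚ) 2 := goodOrd_two_n4307
  have ht := not_hasRationalTwoTorsionX_n4307
  have hθ := aeval_theta_n4307 hβ
  have h3 := finrank_cubicField_n4307 hβ
  have hd : ¬ (2 : ℤ) ∣ NumberField.discr ↥(IntermediateField.adjoin ℚ ({β} : Set (AlgebraicClosure ℚ))) := by
    rw [CubicDisc4307.discr_eq h3 hθ]; norm_num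
  obtain ⟨ψ, hψ⟩ := exists_residueHom_q hβ
  obtain ⟨χ, hχ⟩ := Summit.BirchSwinnertonDyer.BirchSwinnertonDyer.Theorems.AlignedTransportAtTwoCubicOrderFourRowN4307.exists_residueHom_eps_n4307 hβ
  have hmax := isMaximal_span_q0_n4307 hβ
  have hN2 := absNorm_span_pi1_n4307 hβ
  set θI : 𝓞 ↥(IntermediateField.adjoin ℚ ({β} : Set (AlgebraicClosure ℚ))) := MonicCubic.thetaInt hθ with hθI
  have hrel : θI ^ 3 + (-3 : 𝓞 ↥(IntermediateField.adjoin ℚ ({β} : Set (AlgebraicClosure ℚ)))) * θI ^ 2 + (-1 : 𝓞 ↥(IntermediateField.adjoin ℚ ({β} : Set (AlgebraicClosure ℚ)))) * θI + (-10 : 𝓞 ↥(IntermediateField.adjoin ℚ ({β} : Set (AlgebraicClosure ℚ)))) = 0 := by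
    have h := MonicCubic.thetaInt_rel hθ
    rw [← hθI] at h
    push_cast at h
    linear_combination h
  have hεmul : ((3463 + 1232 * θI + 1354 * θI ^ 2 : 𝓞 ↥(IntermediateField.adjoin ℚ ({β} : Set (AlgebraicClosure ℚ))))) * (((-113) + 68 * θI + (-10) * θI ^ 2 : 𝓞 ↥(IntermediateField.adjoin ℚ ({β} : Set (AlgebraicClosure ℚ))))) = 1 := by
    linear_combination (39132 + (-13540) * θI : 𝓞 ↥(IntermediateField.adjoin ℚ ({β} : Set (AlgebraicClosure ℚ)))) * hrel
  have hχε : χ ((3463 + 1232 * θI + 1354 * θI ^ 2 : 𝓞 ↥(IntermediateField.adjoin ℚ ({β} : Set (AlgebraicClosure ℚ))))) = (3 : ZMod 5) := by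
    simp only [map_add, map_mul, map_pow, map_ofNat, hχ]; decide
  have hnsq : ∀ z : (𝓞 ↥(IntermediateField.adjoin ℚ ({β} : Set (AlgebraicClosure ℚ))))ˣ, Units.mkOfMulEqOne _ _ hεmul ≠ z ^ 2 ∧ Units.mkOfMulEqOne _ _ hεmul ≠ -z ^ 2 := by
    intro z
    refine ⟨fun h => ?_, fun h => ?_⟩
    · have h' := congrArg (fun w : (𝓞 ↥(IntermediateField.adjoin ℚ ({β} : Set (AlgebraicClosure ℚ))))ˣ => χ (w : 𝓞 ↥(IntermediateField.adjoin ℚ ({β} : Set (AlgebraicClosure ℚ))))) h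
      simp only [Units.val_mkOfMulEqOne, Units.val_pow_eq_pow_val, map_pow] at h'
      rw [hχε] at h'
      exact absurd h'.symm (by generalize χ (z : 𝓞 ↥(IntermediateField.adjoin ℚ ({β} : Set (AlgebraicClosure ℚ)))) = u; revert u; decide)
    · have h' := congrArg (fun w : (𝓞 ↥(IntermediateField.adjoin ℚ ({β} : Set (AlgebraicClosure ℚ))))ˣ => χ (w : 𝓞 ↥(IntermediateField.adjoin ℚ ({β} : Set (AlgebraicClosure ℚ))))) h
      simp only [Units.val_mkOfMulEqOne, Units.val_neg, Units.val_pow_eq_pow_val, map_neg, map_pow] at h'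
      rw [hχε] at h'
      exact absurd h'.symm (by generalize χ (z : 𝓞 ↥(IntermediateField.adjoin ℚ ({β} : Set (AlgebraicClosure ℚ)))) = u; revert u; decide)
  have hε : (Units.mkOfMulEqOne _ _ hεmul : (𝓞 ↥(IntermediateField.adjoin ℚ ({β} : Set (AlgebraicClosure ℚ))))ˣ).val - 1 ∈ Ideal.span {(-4 + θI : 𝓞 ↥(IntermediateField.adjoin ℚ ({β} : Set (AlgebraicClosure ℚ))))} ^ 3 ∨ (Units.mkOfMulEqOne _ _ hεmul : (𝓞 ↥(IntermediateField.adjoin ℚ ({β} : Set (AlgebraicClosure ℚ))))ˣ).val + 1 ∈ Ideal.span {(-4 + θI : 𝓞 ↥(IntermediateField.adjoin ℚ ({β} : Set (AlgebraicClosure ℚ))))} ^ 3 := by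
    refine Or.inr ?_
    rw [Units.val_mkOfMulEqOne, Ideal.span_singleton_pow, Ideal.mem_span_singleton']
    exact ⟨((-4734486) + (-1684346) * θI + (-1851136) * θI ^ 2 : 𝓞 ↥(IntermediateField.adjoin ℚ ({β} : Set (AlgebraicClosure ℚ)))), by linear_combination ((-30300364) + 14975878 * θI + (-1851136) * θI ^ 2 : 𝓞 ↥(IntermediateField.adjoin ℚ ({β} : Set (AlgebraicClosure ℚ)))) * hrel⟩
  have hπ : (((-11) + 3 * θI : 𝓞 ↥(IntermediateField.adjoin ℚ ({β} : Set (AlgebraicClosure ℚ))))) - 3 ∈ Ideal.span {(-4 + θI : 𝓞 ↥(IntermediateField.adjoin ℚ ({β} : Set (AlgebraicClosure ℚ))))} ^ 3 ∨ (((-11) + 3 * θI : 𝓞 ↥(IntermediateField.adjoin ℚ ({β} : Set (AlgebraicClosure ℚ))))) + 3 ∈ Ideal.span {(-4 + θI : 𝓞 ↥(IntermediateField.adjoin ℚ ({β} : Set (AlgebraicClosure ℚ))))} ^ 3 := by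
    refine Or.inl ?_
    rw [Ideal.span_singleton_pow, Ideal.mem_span_singleton']
    exact ⟨(371 + 132 * θI + 145 * θI ^ 2 : 𝓞 ↥(IntermediateField.adjoin ℚ ({β} : Set (AlgebraicClosure ℚ)))), by linear_combination (2373 + (-1173) * θI + 145 * θI ^ 2 : 𝓞 ↥(IntermediateField.adjoin ℚ ({β} : Set (AlgebraicClosure ℚ)))) * hrel⟩
  have hψq : ψ (((-11) + 3 * θI : 𝓞 ↥(IntermediateField.adjoin ℚ ({β} : Set (AlgebraicClosure ℚ))))) = 0 := by
    simp only [map_add, map_mul, map_neg, map_ofNat, hψ]; decide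
  have hεy : (((-3463) + (-1232) * θI + (-1354) * θI ^ 2 : 𝓞 ↥(IntermediateField.adjoin ℚ ({β} : Set (AlgebraicClosure ℚ))))) * ((113 + (-68) * θI + 10 * θI ^ 2 : 𝓞 ↥(IntermediateField.adjoin ℚ ({β} : Set (AlgebraicClosure ℚ))))) = 1 := by
    linear_combination (39132 + (-13540) * θI : 𝓞 ↥(IntermediateField.adjoin ℚ ({β} : Set (AlgebraicClosure ℚ)))) * hrel
  exact AlignedTransportAtTwoCubicLayerTwoRelationDoor.classicalMuVanishes_adjoin_of_relationCert_layer_two ((⟨1, 0, 0, -3, -4⟩ : WeierstrassCurve ℤ).baseChange ℚ) hord ht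
    minimalDiscriminantInt_emod_eight_n4307 Δ_n4307_neg hβ (not_two_dvd_classNumber_cubicField_n4307 hβ) hd (Ideal.span {(-4 + θI : 𝓞 ↥(IntermediateField.adjoin ℚ ({β} : Set (AlgebraicClosure ℚ))))}) hN2 hε hnsq κP hκP
    (((-11) + 3 * θI : 𝓞 ↥(IntermediateField.adjoin ℚ ({β} : Set (AlgebraicClosure ℚ))))) hmax hπ 42 (q := 127) (by norm_num) ψ hψq (ti := 64) (by decide) (by decide)
    (((-2178217737087657781758385) + (-776640355437653967688640) * θI + (-851613769467214056347405) * θI ^ 2 : 𝓞 ↥(IntermediateField.adjoin ℚ ({β} : Set (AlgebraicClosure ℚ))))) ((402175528925435791158172 + (-392418865665816825058916) * θI + 74057708009269763363365 * θI ^ 2 : 𝓞 ↥(IntermediateField.adjoin ℚ ({β} : Set (AlgebraicClosure ℚ))))) (by push_cast; linear_combination (46567170565798839818313673153275 + (-89760432937144811754253398354540) * θI + 74158050066853124642893294403385 * θI ^ 2 + (-34030031051866676662476735418665) * θI ^ 3 + 9368884235198527085942405139690 * θI ^ 4 + (-1547648614754137374196163011335) * θI ^ 5 + 142040328420132526475305037025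 * θI ^ 6 + (-5587437941474391423695324205) * θI ^ 7 : 𝓞 ↥(IntermediateField.adjoin ℚ ({β} : Set (AlgebraicClosure ℚ)))) * hrel)
    ((3679 + 1317 * θI + 1404 * θI ^ 2 : 𝓞 ↥(IntermediateField.adjoin ℚ ({β} : Set (AlgebraicClosure ℚ))))) (-192) (by push_cast; linear_combination ((-42903) + 12636 * θI : 𝓞 ↥(IntermediateField.adjoin ℚ ({β} : Set (AlgebraicClosure ℚ)))) * hrel)
    ((-1) + 3 * θI + (-2) * θI ^ 2 : 𝓞 ↥(IntermediateField.adjoin ℚ ({β} : Set (AlgebraicClosure ℚ)))) ((-18) + 13 * θI + (-9) * θI ^ 2 : 𝓞 ↥(IntermediateField.adjoin ℚ ({β} : Set (AlgebraicClosure ℚ)))) (27 + 3 * θI + 15 * θI ^ 2 : 𝓞 ↥(IntermediateField.adjoin ℚ ({β} : Set (AlgebraicClosure ℚ)))) (25 + 16 * θI + 16 * θI ^ 2 : 𝓞 ↥(IntermediateField.adjoin ℚ ({β} : Set (AlgebraicClosure ℚ)))) ((-1) + (-3) * θI + (-17) * θI ^ 2 : 𝓞 ↥(IntermediateField.adjoin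 ℚ ({β} : Set (AlgebraicClosure ℚ)))) (35 + 50 * θI + (-28) * θI ^ 2 : 𝓞 ↥(IntermediateField.adjoin ℚ ({β} : Set (AlgebraicClosure ℚ)))) ((-37) + (-14) * θI + 11 * θI ^ 2 : 𝓞 ↥(IntermediateField.adjoin ℚ ({β} : Set (AlgebraicClosure ℚ)))) ((-15) + 47 * θI + 12 * θI ^ 2 : 𝓞 ↥(IntermediateField.adjoin ℚ ({β} : Set (AlgebraicClosure ℚ)))) (33 + (-21) * θI + 3 * θI ^ 2 : 𝓞 ↥(IntermediateField.adjoin ℚ ({β} : Set (AlgebraicClosure ℚ)))) (5 + 2 * θI + (-1) * θI ^ 2 : 𝓞 ↥(IntermediateField.adjoin ℚ ({β} : Set (AlgebraicClosure ℚ)))) (3 + (-24) * θI + 6 * θI ^ 2 : 𝓞 ↥(IntermediateField.adjoin ℚ ({β} : Set (AlgebraicClosure ℚ)))) ((-29) + 32 * θI + (-6) * θI ^ 2 : 𝓞 ↥(IntermediateField.adjoin ℚ ({β} : Set (AlgebraicClosure ℚ))))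
    (by push_cast; linear_combination ((-4983) + (-3834) * θI + 2133 * θI ^ 2 + (-162) * θI ^ 3 : 𝓞 ↥(IntermediateField.adjoin ℚ ({β} : Set (AlgebraicClosure ℚ)))) * hrel) (by push_cast; linear_combination (43734 + (-37080) * θI + 9558 * θI ^ 2 + (-729) * θI ^ 3 : 𝓞 ↥(IntermediateField.adjoin ℚ ({β} : Set (AlgebraicClosure ℚ)))) * hrel) (by push_cast; linear_combination ((-59922) + 51543 * θI + (-13932) * θI ^ 2 + 1215 * θI ^ 3 : 𝓞 ↥(IntermediateField.adjoin ℚ ({β} : Set (AlgebraicClosure ℚ)))) * hrel) (by push_cast; linear_combination ((-38433) + 42948 * θI + (-13824) * θI ^ 2 + 1296 * θI ^ 3 : 𝓞 ↥(IntermediateField.adjoin ℚ ({β} : Set (AlgebraicClosure ℚ)))) * hrel)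
    ((-5) + 3 * θI + (-24) * θI ^ 2 : 𝓞 ↥(IntermediateField.adjoin ℚ ({β} : Set (AlgebraicClosure ℚ)))) (1 + (-8) * θI + 12 * θI ^ 2 : 𝓞 ↥(IntermediateField.adjoin ℚ ({β} : Set (AlgebraicClosure ℚ)))) ((-20) + (-2) * θI + 6 * θI ^ 2 : 𝓞 ↥(IntermediateField.adjoin ℚ ({β} : Set (AlgebraicClosure ℚ)))) ((-9) + (-10) * θI + 19 * θI ^ 2 : 𝓞 ↥(IntermediateField.adjoin ℚ ({β} : Set (AlgebraicClosure ℚ)))) (5 + (-1) * θI + (-13) * θI ^ 2 : 𝓞 ↥(IntermediateField.adjoin ℚ ({β} : Set (AlgebraicClosure ℚ)))) (6 + 3 * θI + (-7) * θI ^ 2 : 𝓞 ↥(IntermediateField.adjoin ℚ ({β} : Set (AlgebraicClosure ℚ)))) (3 + 5 * θI + (-6) * θI ^ 2 : 𝓞 ↥(IntermediateField.adjoin ℚ ({β} : Set (AlgebraicClosure ℚ)))) (4 + 24 * θI + (-8) * θI ^ 2 : 𝓞 ↥(IntermediateField.adjoin ℚ ({β} : Set (AlgebraicClosure ℚ))))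 ((-10) + (-1) * θI + 14 * θI ^ 2 : 𝓞 ↥(IntermediateField.adjoin ℚ ({β} : Set (AlgebraicClosure ℚ)))) ((-3) + (-3) * θI + 7 * θI ^ 2 : 𝓞 ↥(IntermediateField.adjoin ℚ ({β} : Set (AlgebraicClosure ℚ)))) ((-6) * θI + 6 * θI ^ 2 : 𝓞 ↥(IntermediateField.adjoin ℚ ({β} : Set (AlgebraicClosure ℚ)))) (1 + (-24) * θI + 8 * θI ^ 2 : 𝓞 ↥(IntermediateField.adjoin ℚ ({β} : Set (AlgebraicClosure ℚ))))
    (by push_cast; linear_combination (963 + (-216) * θI : 𝓞 ↥(IntermediateField.adjoin ℚ ({β} : Set (AlgebraicClosure ℚ)))) * hrel) (by push_cast; linear_combination ((-540) + 108 * θI : 𝓞 ↥(IntermediateField.adjoin ℚ ({β} : Set (AlgebraicClosure ℚ)))) * hrel) (by push_cast; linear_combination ((-252) + 54 * θI : 𝓞 ↥(IntermediateField.adjoin ℚ ({β} : Set (AlgebraicClosure ℚ)))) * hrel) (by push_cast; linear_combination ((-831) + 171 * θI : 𝓞 ↥(IntermediateField.adjoin ℚ ({β} : Set (AlgebraicClosure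 ℚ)))) * hrel)
    (1 + (-5) * θI + (-2) * θI ^ 2 : 𝓞 ↥(IntermediateField.adjoin ℚ ({β} : Set (AlgebraicClosure ℚ)))) ((-6) + 1 * θI + (-2) * θI ^ 2 : 𝓞 ↥(IntermediateField.adjoin ℚ ({β} : Set (AlgebraicClosure ℚ)))) ((-4) + 1 * θI : 𝓞 ↥(IntermediateField.adjoin ℚ ({β} : Set (AlgebraicClosure ℚ)))) (1 + (-1) * θI : 𝓞 ↥(IntermediateField.adjoin ℚ ({β} : Set (AlgebraicClosure ℚ)))) (317245 + 326628 * θI + 65431 * θI ^ 2 : 𝓞 ↥(IntermediateField.adjoin ℚ ({β} : Set (AlgebraicClosure ℚ)))) (54038 + 102207 * θI + 76191 * θI ^ 2 : 𝓞 ↥(IntermediateField.adjoin ℚ ({β} : Set (AlgebraicClosure ℚ)))) ((-345408) + 192749 * θI + (-150937) * θI ^ 2 : 𝓞 ↥(IntermediateField.adjoin ℚ ({β} : Set (AlgebraicClosure ℚ)))) ((-33083) + 25262 * θI + (-116809) * θI ^ 2 : 𝓞 ↥(IntermediateField.adjoin ℚ ({β} : Set (AlgebraicClosure ℚ)))) ((-15)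 + (-8) * θI + 3 * θI ^ 2 : 𝓞 ↥(IntermediateField.adjoin ℚ ({β} : Set (AlgebraicClosure ℚ)))) (4 + (-5) * θI + 1 * θI ^ 2 : 𝓞 ↥(IntermediateField.adjoin ℚ ({β} : Set (AlgebraicClosure ℚ)))) ((-10) + (-13) * θI + 4 * θI ^ 2 : 𝓞 ↥(IntermediateField.adjoin ℚ ({β} : Set (AlgebraicClosure ℚ)))) ((-15) + 1 * θI ^ 2 : 𝓞 ↥(IntermediateField.adjoin ℚ ({β} : Set (AlgebraicClosure ℚ))))
    (by push_cast; linear_combination ((-387843) + (-588879) * θI : 𝓞 ↥(IntermediateField.adjoin ℚ ({β} : Set (AlgebraicClosure ℚ)))) * hrel) (by push_cast; linear_combination (2051586 + (-685719) * θI : 𝓞 ↥(IntermediateField.adjoin ℚ ({β} : Set (AlgebraicClosure ℚ)))) * hrel) (by push_cast; linear_combination ((-7621284) + 1358433 * θI : 𝓞 ↥(IntermediateField.adjoin ℚ ({β} : Set (AlgebraicClosure ℚ)))) * hrel) (by push_cast; linear_combination ((-4782909) + 1051281 * θI : 𝓞 ↥(IntermediateField.adjoin ℚ ({β} : Set (AlgebraicClosure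 ℚ)))) * hrel)
    (Units.mkOfMulEqOne _ _ hεy) (by rw [Units.val_mkOfMulEqOne]; linear_combination ((-5070420) + 4234390 * θI + (-1179978) * θI ^ 2 + 110098 * θI ^ 3 + (-176) * θI ^ 4 + 16 * θI ^ 5 : 𝓞 ↥(IntermediateField.adjoin ℚ ({β} : Set (AlgebraicClosure ℚ)))) * hrel)

/-- ★★ **`μ₂(κ) = 0` — UNCONDITIONAL — for every cyclotomic `ℤ₂`-extension `κ` of the cubic field of discriminant `−4307`**, by the layer-two relation road.
[cite: Washington1997, §13.3] [cite: LMFDB, number field 3.1.4307.1] -/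
theorem classicalMuVanishes_cubicField_n4307_unconditional {β : AlgebraicClosure ℚ} (hβ : aeval β ((⟨1, 0, 0, -3, -4⟩ : WeierstrassCurve ℤ).baseChange ℚ).twoTorsionPolynomial.toPoly = 0)
    (κP : ZpExtension ↥(IntermediateField.adjoin ℚ ({β} : Set (AlgebraicClosure ℚ))) 2) (hκP : κP.IsCyclotomic) : ClassicalMuVanishes κP :=
  (classGroupPRank_le_two_and_mu_lambda_cubicField_n4307 hβ κP hκP).2.1

/-! ## §3 `MC₂(W)` at the seed modulo PRINT (att-p5 g24's cubic carrier road with its `μ₂ = 0` input DISCHARGED) -/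

/-- The `2`-division cubic of `⟨1, 0, 0, -3, -4⟩` has a root in `ℚ̄`. [cite: SilvermanAEC2009, III.1] -/
theorem exists_root_twoTorsionPolynomial_n4307 :
    ∃ β : AlgebraicClosure ℚ, aeval β ((⟨1, 0, 0, -3, -4⟩ : WeierstrassCurve ℤ).baseChange ℚ).twoTorsionPolynomial.toPoly = 0 := by
  apply IsAlgClosed.exists_aeval_eq_zero
  rw [Cubic.degree_of_a_ne_zero (by simp [WeierstrassCurve.twoTorsionPolynomial])]
  decide

/-- ★ **`C2` AT THE SEED `⟨1, 0, 0, -3, -4⟩` (`N = 4307`) modulo PRINT⁵ + MuIneqʳ + the crux's own hypotheses at this `W`** — att-p5 g24's carrier road with its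
`μ₂ = 0` input DISCHARGED by the layer-two relation row.  CONDITIONAL; BSD is NOT proved; nothing is closed.
[cite: Kato2004Asterisque, Thm. 17.4 (1)(2) (p. 273)] [cite: GreenbergLNM1716, Thm. 4.1 (p. 102) and Conj. 1.11 (p. 58)] [cite: Iwasawa1973MuInvariants, Thm. 2 and Thm. 3] -/
theorem mazurMainConjecture_two_n4307_of_print
    [((⟨1, 0, 0, -3, -4⟩ : WeierstrassCurve ℤ).baseChange ℚ).IsElliptic] [((⟨1, 0, 0, -3, -4⟩ : WeierstrassCurve ℤ).baseChange ℚ).IsGloballyMinimal]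
    (h17 : ∀ [NeZero (((⟨1, 0, 0, -3, -4⟩ : WeierstrassCurve ℤ).baseChange ℚ).conductorNorm ℤ)] (f : CuspForm (Gamma0 (((⟨1, 0, 0, -3, -4⟩ : WeierstrassCurve ℤ).baseChange ℚ).conductorNorm ℤ)) 2),
      kato_divisibility_allPrimes ((⟨1, 0, 0, -3, -4⟩ : WeierstrassCurve ℤ).baseChange ℚ) 2 (f := f))
    (hGr : Greenberg1999.thm41_charValue_rankZero_anyPrime)
    (hper : realPeriodRat_eq_unit_mul_plusPeriod_two) (hmod : nonempty_modularParametrizationData)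
    (hGZK : rank_eq_analyticRank_of_analyticRank_le_one)
    (hI : ∀ (W : WeierstrassCurve ℚ) [W.IsElliptic] [W.IsGloballyMinimal], IsOrdinaryAt W 2 →
      (∀ x : ℚ, ¬ HasRationalTwoTorsionX W x) →
      ∀ (κ : ZpExtension ℚ 2) (γ : Field.absoluteGaloisGroup ℚ), κ.IsCyclotomic →
      κ.IsTopGenerator γ → IsCyclotomicVariable 2 γ →
      ∀ ⦃N : ℕ⦄ [NeZero N] (f : CuspForm (Gamma0 N) 2), IsNewformOf W f →
      ∀ Gp : IwasawaAlgebra 2, iwasawaToPowerSeries 2 Gp = padicLFunction f (unitRoot W 2 : ℚ_[2]) →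
      ∀ (D : W.SelmerDualData κ γ) (Yr : W.FineSelmerDualDataRelaxedInf κ γ),
        lengthAt (IwasawaAlgebra 2) D.X ⟨IwasawaAlgebra.augIdealP 2, IwasawaAlgebra.isPrime_augIdealP_holds 2⟩ ≤
          lengthAt (IwasawaAlgebra 2) (IwasawaAlgebra 2 ⧸ Ideal.span {Gp})
              ⟨IwasawaAlgebra.augIdealP 2, IwasawaAlgebra.isPrime_augIdealP_holds 2⟩ +
            lengthAt (IwasawaAlgebra 2) Yr.X ⟨IwasawaAlgebra.augIdealP 2, IwasawaAlgebra.isPrime_augIdealP_holds 2⟩)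
    (hr : ((⟨1, 0, 0, -3, -4⟩ : WeierstrassCurve ℤ).baseChange ℚ).analyticRank = 0)
    (hμan : ∀ ⦃N : ℕ⦄ [NeZero N] (f : CuspForm (Gamma0 N) 2), IsNewformOf ((⟨1, 0, 0, -3, -4⟩ : WeierstrassCurve ℤ).baseChange ℚ) f →
      ∀ G : IwasawaAlgebra 2, IsEvenBranchLiftAtTwo ((⟨1, 0, 0, -3, -4⟩ : WeierstrassCurve ℤ).baseChange ℚ) f G → red G ≠ 0)
    (hbsd : BSDp ((⟨1, 0, 0, -3, -4⟩ : WeierstrassCurve ℤ).baseChange ℚ) 2) :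
    MazurMainConjecture ((⟨1, 0, 0, -3, -4⟩ : WeierstrassCurve ℤ).baseChange ℚ) 2 := by
  obtain ⟨β, hβ⟩ := exists_root_twoTorsionPolynomial_n4307
  have hord : IsOrdinaryAt ((⟨1, 0, 0, -3, -4⟩ : WeierstrassCurve ℤ).baseChange ℚ) 2 := goodOrd_two_n4307
  exact mazurMainConjecture_two_of_muIneqRel_of_classicalMu_cubicField_of_Δ_neg ((⟨1, 0, 0, -3, -4⟩ : WeierstrassCurve ℤ).baseChange ℚ) h17 hGr hper hmod hGZK hI hord
    not_hasRationalTwoTorsionX_n4307 Δ_n4307_neg hr hμan hbsd hβ (fun κP hκP =>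
      (classGroupPRank_le_two_and_mu_lambda_cubicField_n4307 hβ κP hκP).2.1)

end Summit.BirchSwinnertonDyer.BirchSwinnertonDyer.Theorems.AlignedTransportAtTwoCubicLayerTwoRelationRowN4307

end
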